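import Summits.BirchSwinnertonDyer.BirchSwinnertonDyer.Theorems.KatoDescentPotSupersingularWildLowerHalfRankZero
import Summits.BirchSwinnertonDyer.BirchSwinnertonDyer.Theorems.KatoDescentKMCImpReading
import HarnessLib

/-!
# Route `KatoDescentPotSupersingular` (rung K9, cell `bsd-potss`): the crux `WildLowerHalfRankZero`
# (item stmt-BirchSwinnertonDyer-19195) FROM KATO'S MAIN CONJECTURE 12.10 AT THE CLOSED BINDERS —
# planner SKETCH of duty W1′ (bsd-potss-plan g28; `--supports stmt-BirchSwinnertonDyer-19195 --as helper`)

WHAT. §2 of `KatoDescentPotSupersingularWildLowerHalfRankZero.lean` proves the crux BY NAME from Kato's Main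
Conjecture at the `3`-torsion-free wild members over the INTERFACE triple `(IsOf, KMC)` and the interface lemma
`ReadsTrivialKMC IsOf KMC` (an iff). Cell bsd-cm has since CLOSED the binders
(`Rank1Residual/Additive/KatoDescentClosedBinders.lean`, p612876: `IsKatoZetaDescentDatumOf`,
`@[conjecture] KatoMainConjectureFine`) and proved the `→` half of the reading in the kernel
(`KatoDescentKMCImpReading.conj1210_of_isOf_of_kmcFine`) together with the rank-`0` descent over the `→`-only
binder (`KatoDescentKMCImpReading.missingPPartAt_rankZero_of_kmcImp`). This file INSTANTIATES the route road at the
closed triple: `WildLowerHalfRankZero` follows from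

* the two image-free readings 1♭ / 3♭ of `Additive/KatoDescentTorsionFreeReadings.lean` at the CLOSED `IsOf`
  (`TorsionFree.DescentCountReading IsKatoZetaDescentDatumOf`,
  `TorsionFree.RealizableOfKMC IsKatoZetaDescentDatumOf KatoMainConjectureFine`) — PRINT readings of Kato
  Prop. 14.16 (2) / Thm. 12.4 / Thm. 12.5 (4) / (14.14.1), displayed as hypotheses;
* the published facts Cassels (isogeny invariance of the BSD quotient), Gross–Zagier–Kolyvagin, modularity,
  Mazur–Kenku — displayed as hypotheses;
* `KatoMainConjectureFine W' 3` at every `3`-torsion-free additive potentially good curve `W'` of analytic rank `0`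
  — an OPEN CONJECTURE (Kato, Astérisque 295, Conj. 12.10; no divisibility of a main conjecture is in print at an
  additive prime), displayed as the hypothesis `hK`;

with NO interface-lemma hypothesis. HONEST LABEL: conditional over displayed hypotheses; closes NOTHING (the item
19195 stays open: its mathematical content on the residual rows IS `hK`); nothing about Kato's Main Conjecture or BSD
is asserted; BSD is proved for no curve. From this file on, the cell's outcome token for the K9/KT lower halves reads
«open-problem: Kato Conj. 12.10 for T_3W at an additive potentially good 3 (`Additive.KatoMainConjectureFine W 3`) on the
residual rows», not «blocked-on: defn-KatoMainConjecture» (definition request D-O6-2 is discharged in substance by the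
closed binders).
[cite: Kato2004Asterisque, Conj. 12.10 (p. 224), §14.14 and Lemma 14.15 (pp. 243–244), Prop. 14.16 (2) (p. 244)]
[cite: Cassels1965ArithmeticVIII] [cite: SilvermanAEC2009, IX.6 Example 6.4]
-/

set_option autoImplicit false
set_option linter.dupNamespace false

noncomputable section

open scoped Classical

namespace Summit.BirchSwinnertonDyer.BirchSwinnertonDyer.Theorems

open WeierstrassCurve Literature.NumberTheory.EllipticCurves
  Literature.NumberTheory.EllipticCurves.ModularForms
  Literature.NumberTheory.EllipticCurves.Rank1Residual
  Literature.NumberTheory.EllipticCurves.Rank1Residual.Typed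
  Summit.BirchSwinnertonDyer.Rank1Residual.Additive
  Summit.BirchSwinnertonDyer.Rank1Residual
  Summit.BirchSwinnertonDyer.BirchSwinnertonDyer.Theses.KatoDescentPotSupersingular

/-- **`WildLowerHalfRankZero` (K9 crux 19195) from Kato's Main Conjecture 12.10 at the CLOSED binders**: the §2
DescentGlue of `KatoDescentPotSupersingularWildLowerHalfRankZero.lean` instantiated at
`(IsOf, KMC) := (IsKatoZetaDescentDatumOf, KatoMainConjectureFine)`, the interface lemma DISCHARGED by bsd-cm's
`KatoDescentKMCImpReading.conj1210_of_isOf_of_kmcFine`; reduction to the `3`-torsion-free members by §1's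
`wildLowerHalfRankZero_of_torsionFree_rows` (Mazur–Kenku + Cassels). Conditional; the item is NOT closed.
[cite: Kato2004Asterisque, Conj. 12.10 (p. 224), Prop. 14.16 (2) (p. 244)] [cite: Cassels1965ArithmeticVIII] -/
theorem wildLowerHalfRankZero_of_kmcFine
    (hR : TorsionFree.DescentCountReading IsKatoZetaDescentDatumOf)
    (hreal : TorsionFree.RealizableOfKMC IsKatoZetaDescentDatumOf KatoMainConjectureFine)
    (hCassels : bsdRHS_eq_of_isIsogenous) (hGZK : rank_eq_analyticRank_of_analyticRank_le_one)
    (hmod : hasEntireLFunction_rat) (hMK : mazurKenku_exists_cyclic_isogeny)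
    (hK : ∀ (W : WeierstrassCurve ℚ) [W.IsElliptic] [W.IsGloballyMinimal],
      W.analyticRank = 0 → Addv W 3 → 0 ≤ padicValRat 3 W.j → ¬ 3 ∣ W.torsionOrder →
        KatoMainConjectureFine W 3) :
    WildLowerHalfRankZero :=
  wildLowerHalfRankZero_of_torsionFree_rows hCassels hGZK hmod hMK fun W' _ _ hr' hadd' hj' ht' ↦
    (lower_and_upper_of_missingPPartAt W' 3
      (KatoDescentKMCImpReading.missingPPartAt_rankZero_of_kmcImp W' 3 hR hreal
        KatoDescentKMCImpReading.conj1210_of_isOf_of_kmcFine hGZK hmod hr' (by decide) hadd' hj' ht'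
        (hK W' hr' hadd' hj' ht'))).1

end Summit.BirchSwinnertonDyer.BirchSwinnertonDyer.Theorems

end
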